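import Summits.AnomalousDissipation.AnomalousDissipation.Theorems.RootDecompCycle2BTaylorBridge

/-!
# `RootDecompCycle2B.StretchTaylorBridge` (stmt-AnomalousDissipation-27953) is a theorem

The support item W_S («H_T ⇒ A′») of `route-AnomalousDissipation-RootDecompCycle2B` (β′ TaylorStretches, wavenumber axis of the
loud STRETCHES): loud stretches that are CAPPED IN TAYLOR BOXES (`ν_j(K_j² + 1) ≥ 1`, running-mean box energy `≤ E` on the stretch
`[T₀, T₀ + τ]`, `T₀ ≥ 1`) are loud stretches in the sense of `RootDecompCycle2B.LoudStretches` with full running-mean energy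
`≤ 4E + E₀ + ‖f‖₂²` on the stretch — by the fixed-viscosity Taylor bridge
`Theorems.TaylorBridge.timeMean_energy_le_of_timeMean_lowEnergy_le` (landed with item 26917).  No facts asserted.
Source: decomp-ad cell, lens-5 g4 node «TaylorStretches» (kernel `run/shared/lean/pub/decomp-ad/decomp-ad-lens-5/TaylorStretches.lean`,
theorem `stretchTaylorBridge_holds`); landed by the cell's prover seat.  Nothing here proves the summit.
-/

set_option linter.dupNamespace false

noncomputable section

namespace Summit.AnomalousDissipation.AnomalousDissipation.Theorems.TaylorBridge

open MeasureTheory Filter Topology Set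
open Literature.Analysis.FunctionSpaces Literature.Analysis.FluidPDE
open Summit.AnomalousDissipation.AnomalousDissipation.Theses

/-- **Item 27953 `RootDecompCycle2B.StretchTaylorBridge` holds**: Taylor-capped loud stretches are loud stretches with the
energy cap `4E + E₀ + ‖f‖₂²` on the stretch. [folklore] -/
theorem stretchTaylorBridge_holds : RootDecompCycle2B.StretchTaylorBridge := by
  intro h
  obtain ⟨f, ν, E₀, E, ε, hdata, Kb, hKb, hall⟩ := h
  obtain ⟨hf, hdiv, hmean, hν, hν0, hε⟩ := hdata
  refine ⟨f, ν, E₀, 4 * E + E₀ + ∫ x, ‖f x‖ ^ 2, ε, ⟨hf, hdiv, hmean, hν, hν0, hε⟩, fun τ => ?_⟩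
  obtain ⟨j₀, hj⟩ := hall τ
  refine ⟨j₀, fun j hjj => ?_⟩
  obtain ⟨T₀, hT₀, K, u₀, u, hcap, hLH, hS⟩ := hj j hjj
  refine ⟨T₀, by linarith, K, u₀, u, hcap, hLH, fun T hT hTτ => ?_⟩
  have h := hS T hT hTτ
  exact ⟨timeMean_energy_le_of_timeMean_lowEnergy_le (hν j) hf hmean hLH (hKb j) hcap (hT₀.trans hT) h.1, h.2⟩

end Summit.AnomalousDissipation.AnomalousDissipation.Theorems.TaylorBridge

end
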